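import Mathlib
import Summits.NavierStokesRegularity.NavierStokesRegularity.Theorems.FilamentSkeletonRssClause13ModelFarPointwise
import Summits.NavierStokesRegularity.NavierStokesRegularity.Theorems.FilamentSkeletonRssClause13PieceSup

/-!
# Clause 13-J/13-R, brick m3 (MODEL, POINTWISE ON THE BALL): `sup_{ball}‖Y‖ ≤ 2·[(C_N + C_H·Gε_X(1+‖k‖₁))·N(Y) + C_H·((1+‖k‖₁)·sup‖𝓛Y‖ + Λ·S_T)]`

Route `FilamentSkeletonRss`, ∃-side clause 13 (`Clause13RNearStraightL`, stmt-NavierStokesRegularity-23612; typing-agnostic).  Design of record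
rev 80–82 (m3 = `L² → L^∞`; memo `DESIGN-28296-model-L2closed-and-Linfty-g17.md` §3–§4 and the NOT DECOMPOSED YET line).  For a ball-supported
variation `Y ∈ C¹_c([c−R, c+R])` split as `Y = k∗Y + Y_H` by a near kernel `k` (real `C¹`, `k, k′, t k, t²k′ ∈ L¹`, profile `1` unless
`X ≤ |z|√q`):
* the NEAR part is spectrally bounded: `‖(k∗Y)(τ)‖ ≤ C_N·N(Y)`, `C_N = √(‖k‖₁‖k′‖₁)` (Agmon, `norm_piece_le_sqrt_mul_l2`, p711085);
* the FAR part obeys the two-zone pointwise chain on both sides of the waist (`model_far_pointwise_right/left`, `…Clause13ModelFarPointwise`):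
  `‖Y_H(τ)‖ ≤ C_H·M_H` on the ball, `C_H = K·(β₀K)·(R/ℓ)^p` (`ℓ` = half-width of the damped zone, `p` = growth exponent of the amplified zone,
  `K = ((1+k₂)/β₀)/(1−k₂)`, `k₂ = b₂q/(4G)`), `M_H = G·ε_X(1+‖k‖₁)N(Y) + (1+‖k‖₁)S_L + Λ·S_T + c_k·sup‖Y‖`,
  `c_k = Λ₂(‖t²k′‖₁+‖t k‖₁) + (L₁+L₂)‖t k‖₁`;
* ABSORPTION: `sup‖Y‖` is attained (continuity, compact support); if `C_H·c_k ≤ ½` the `sup‖Y‖` on the right is absorbed.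
★ `model_pointwise` — the resulting MODEL `L∞` statement: for every `τ`,
  `‖Y(τ)‖ ≤ 2·[(C_N + C_H·G·ε_X(1+‖k‖₁))·N(Y) + C_H·((1+‖k‖₁)·S_L + Λ·S_T)]`,  `S_L ≥ sup_ℝ‖𝓛Y‖`, `S_T ≥ sup_{ball}‖P_T‖`.
Combined with `model_l2_estimate(_scaled)` (`N(Y) ≤ A·N(𝓛Y)`) and `normSq_windowPiece_le` (for `S_T`) this is the model 13-J∘ in `L∞ ∩ L²`
currency.  HONEST LABEL (memo add1, rev 81): the right side carries `sup_ℝ‖𝓛Y‖` and `N(𝓛Y)` over ℝ (exterior LIA tail included) — the exchange to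
the clause's in-ball pointwise defect ((I)/(II)/(III)) is the booked waist-localisation design point and is NOT done here; in clause scaling
`C_N ~ (X/√q)^{1/2}`, `(R/ℓ)^p` and the `N(·) ≤ √(2R)·sup` conversions are where the `Γ`-uniformity budget is spent.
Lane ns-filament-19175-p1 g18; `--supports stmt-NavierStokesRegularity-23612 --as helper`.
HONEST FRAMING: an a-priori sup estimate for an explicit 1-D model operator attached to a HYPOTHETICAL filament skeleton on the NEGATIVE side of a
MODEL route; nothing here bears on Navier–Stokes regularity or blow-up; 23610/23612 stay OPEN.
-/

noncomputable section

open MeasureTheory Real Complex Filter Set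
open scoped ComplexConjugate Topology

namespace Summit.NavierStokesRegularity.NavierStokesRegularity.Theorems.MatchedKernel
set_option linter.dupNamespace false

/-- Monotonicity of the weight on the ball: for `c < c + ℓ ≤ τ ≤ c + R`, `((τ−c)/ℓ)^p ≤ (R/ℓ)^p` (`p ≥ 0`); and `1 ≤ (R/ℓ)^p`. [folklore] -/
theorem weight_le_on_ball {c ℓ R p τ : ℝ} (hℓ : 0 < ℓ) (hℓR : ℓ ≤ R) (hp : 0 ≤ p) (h1 : c + ℓ ≤ τ) (h2 : τ ≤ c + R) :
    ((τ - c) / (c + ℓ - c)) ^ p ≤ (R / ℓ) ^ p ∧ (1 : ℝ) ≤ (R / ℓ) ^ p := by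
  have e : c + ℓ - c = ℓ := by ring
  rw [e]
  refine ⟨Real.rpow_le_rpow (div_nonneg (by linarith) hℓ.le) (by rw [div_le_div_iff_of_pos_right hℓ]; linarith) hp, ?_⟩
  exact Real.one_le_rpow (by rw [le_div_iff₀ hℓ]; linarith) hp

/-- ★ **THE MODEL IN `L∞` ON THE BALL.**  See the module docstring for the shape; all hypotheses are those of `model_far_pointwise_right` (zone
`[c, c+ℓ] ∪ [c+ℓ, c+R]`) and `model_far_pointwise_left` (zone `[c−R, c−ℓ] ∪ [c−ℓ, c]`) with `0 < ℓ ≤ R`, plus `k′ ∈ L¹`, the support of `Y` in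
`[c−R, c+R]`, `S_T ≥ ‖P_T‖` on the ball, and the absorption condition `C_H·c_k ≤ ½`. [folklore] -/
theorem model_pointwise {q G X : ℝ} (hq : 0 < q) (hG : 0 < G) (hX : 0 < X)
    {k k' : ℝ → ℝ} (hk : ∀ t, HasDerivAt k (k' t) t) (hk'c : Continuous k')
    (hki : Integrable k) (hk'i : Integrable k') (hk1 : Integrable fun t => t * k t) (hk'2 : Integrable fun t => t ^ 2 * k' t)
    {Mk : ℝ} (hkM : ∀ t, |k t| ≤ Mk)
    {χ : ℝ → ℂ} (hkχ : ∀ z : ℝ, ∫ t : ℝ, ((k t : ℝ) : ℂ) * cexp (I * z * t) = χ z) (hfar : ∀ z : ℝ, χ z ≠ 1 → X ≤ |z| * √q)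
    {Y : ℝ → ℂ} (hY : ContDiff ℝ 1 Y) (hYs : HasCompactSupport Y) {c R ℓ : ℝ} (hℓ : 0 < ℓ) (hℓR : ℓ ≤ R)
    (hYR : ∀ x, x ∉ Set.Icc (c - R) (c + R) → Y x = 0)
    {w : ℝ → ℝ} (hw : Differentiable ℝ w) (hw2 : Differentiable ℝ (deriv w)) {Λ Λ₂ : ℝ} (hΛ : ∀ t, |deriv w t| ≤ Λ)
    (hΛ₂ : ∀ t, |deriv (deriv w) t| ≤ Λ₂) {w₁ : ℝ} (hw₁ : 0 < w₁)
    (hwc : w c = 0) (hwpos : ∀ τ ∈ Icc c (c + R), c < τ → 0 < w τ) (hwneg : ∀ τ ∈ Icc (c - R) c, τ < c → w τ < 0)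
    (hww₁ : ∀ τ ∈ Icc (c + ℓ) (c + R), w₁ * (τ - c) ≤ w τ) (hww₁' : ∀ τ ∈ Icc (c - R) (c - ℓ), w₁ * (c - τ) ≤ -w τ)
    {β₁ β₂ β₂' : ℝ → ℂ} (hβ₁c : Continuous β₁) (hβ₂ : ∀ τ, HasDerivAt β₂ (β₂' τ) τ) {b₁ b₂ L₁ L₂ : ℝ}
    (hb₁ : ∀ τ, ‖β₁ τ‖ ≤ b₁) (hb₂ : ∀ τ, ‖β₂ τ‖ ≤ b₂) (hL₁ : ∀ x y, ‖β₁ y - β₁ x‖ ≤ L₁ * |y - x|)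
    (hL₂ : ∀ x y, ‖β₂ y - β₂ x‖ ≤ L₂ * |y - x|) (hsmall : b₂ ≤ 2 * G / q)
    {β₀ p : ℝ} (hβ₀ : 0 < β₀) (hp0 : 0 ≤ p)
    (hgain : ∀ τ ∈ Icc c (c + ℓ), β₀ ≤ -(β₁ τ).re
      - (b₂ / (2 * (2 * G / q))) / (1 - b₂ / (2 * (2 * G / q))) * (2 * |(β₁ τ).im| + b₂ / (2 * (2 * G / q)) * ‖β₂ τ‖)
      - (w τ * ‖β₂' τ‖ / (2 * (2 * G / q))) / (1 - b₂ / (2 * (2 * G / q))))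
    (hgain' : ∀ τ ∈ Icc (c - ℓ) c, β₀ ≤ -(β₁ τ).re
      - (b₂ / (2 * (2 * G / q))) / (1 - b₂ / (2 * (2 * G / q))) * (2 * |(β₁ τ).im| + b₂ / (2 * (2 * G / q)) * ‖β₂ τ‖)
      - (-w τ * ‖β₂' τ‖ / (2 * (2 * G / q))) / (1 - b₂ / (2 * (2 * G / q))))
    (hstag : β₀ ≤ 2 * G / q - ‖β₁ c‖ - ‖β₂ c‖)
    (hgrow : ∀ τ ∈ Icc (c + ℓ) (c + R), (β₁ τ).re + β₀
      + (b₂ / (2 * (2 * G / q))) / (1 - b₂ / (2 * (2 * G / q))) * (2 * |(β₁ τ).im| + b₂ / (2 * (2 * G / q)) * ‖β₂ τ‖)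
      + (w τ * ‖β₂' τ‖ / (2 * (2 * G / q))) / (1 - b₂ / (2 * (2 * G / q))) ≤ p * w₁)
    (hgrow' : ∀ τ ∈ Icc (c - R) (c - ℓ), (β₁ τ).re + β₀
      + (b₂ / (2 * (2 * G / q))) / (1 - b₂ / (2 * (2 * G / q))) * (2 * |(β₁ τ).im| + b₂ / (2 * (2 * G / q)) * ‖β₂ τ‖)
      + (-w τ * ‖β₂' τ‖ / (2 * (2 * G / q))) / (1 - b₂ / (2 * (2 * G / q))) ≤ p * w₁)
    {SL ST : ℝ}
    (hSL : ∀ y : ℝ, ‖I * (G : ℂ) * ((2 / q : ℂ) * Y y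
          - ∫ σ : ℝ, ((((2 * q - (y - σ) ^ 2) * (((y - σ) ^ 2 + q) ^ (5 / 2 : ℝ))⁻¹ : ℝ)) : ℂ) * Y σ)
        - ((w y : ℝ) : ℂ) * deriv Y y + β₁ y * Y y + β₂ y * conj (Y y)‖ ≤ SL)
    (hST : ∀ x ∈ Icc (c - R) (c + R), ‖∫ y : ℝ, (((x - y) * k' (x - y) + k (x - y) : ℝ) : ℂ) * Y y‖ ≤ ST)
    -- absorption condition `C_H · c_k ≤ ½`
    (habs : (((1 + b₂ / (2 * (2 * G / q))) / β₀) / (1 - b₂ / (2 * (2 * G / q))))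
        * (β₀ * (((1 + b₂ / (2 * (2 * G / q))) / β₀) / (1 - b₂ / (2 * (2 * G / q))))) * (R / ℓ) ^ p
        * (Λ₂ * ((∫ t, t ^ 2 * |k' t|) + (∫ t, |t| * |k t|)) + (L₁ + L₂) * (∫ t, |t| * |k t|)) ≤ 1 / 2) :
    ∀ τ : ℝ, ‖Y τ‖ ≤ 2 * ((Real.sqrt ((∫ t, |k t|) * ∫ t, |k' t|)
          + (((1 + b₂ / (2 * (2 * G / q))) / β₀) / (1 - b₂ / (2 * (2 * G / q))))
            * (β₀ * (((1 + b₂ / (2 * (2 * G / q))) / β₀) / (1 - b₂ / (2 * (2 * G / q))))) * (R / ℓ) ^ p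
            * (G * (10 / (q * Real.sqrt (π * √q)) * Real.exp (-(X / 2)) * (1 + ∫ t, |k t|))))
          * (∫ x : ℝ, ‖Y x‖ ^ 2) ^ (1 / 2 : ℝ)
        + (((1 + b₂ / (2 * (2 * G / q))) / β₀) / (1 - b₂ / (2 * (2 * G / q))))
            * (β₀ * (((1 + b₂ / (2 * (2 * G / q))) / β₀) / (1 - b₂ / (2 * (2 * G / q))))) * (R / ℓ) ^ p
          * ((1 + ∫ t, |k t|) * SL + Λ * ST)) := by
  have hkc : Continuous k := continuous_iff_continuousAt.2 fun t => (hk t).continuousAt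
  have hYc := hY.continuous
  have hR : 0 < R := lt_of_lt_of_le hℓ hℓR
  have hGq : 0 < 2 * G / q := by positivity
  have hb20 : 0 ≤ b₂ := (norm_nonneg _).trans (hb₂ 0)
  have hk2 : b₂ / (2 * (2 * G / q)) ≤ 1 / 2 := by rw [div_le_iff₀ (by positivity)]; linarith
  have h1k : 0 < 1 - b₂ / (2 * (2 * G / q)) := by linarith
  have hΛ0 : 0 ≤ Λ := (abs_nonneg _).trans (hΛ 0)
  -- abbreviations
  set K : ℝ := ((1 + b₂ / (2 * (2 * G / q))) / β₀) / (1 - b₂ / (2 * (2 * G / q))) with hKdef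
  have hK0 : 0 < K := by positivity
  have hβ₀K : 1 ≤ β₀ * K := by
    simp only [hKdef]
    rw [show β₀ * ((1 + b₂ / (2 * (2 * G / q))) / β₀ / (1 - b₂ / (2 * (2 * G / q))))
      = (1 + b₂ / (2 * (2 * G / q))) / (1 - b₂ / (2 * (2 * G / q))) by field_simp]
    rw [le_div_iff₀ h1k]
    linarith [show 0 ≤ b₂ / (2 * (2 * G / q)) by positivity]
  set CH : ℝ := K * (β₀ * K) * (R / ℓ) ^ p with hCHdef
  have hRℓ : (1 : ℝ) ≤ (R / ℓ) ^ p := Real.one_le_rpow (by rw [le_div_iff₀ hℓ]; linarith) hp0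
  have hCH0 : 0 < CH := by positivity
  have hKCH : K ≤ CH := by
    simp only [hCHdef]
    have : K * 1 * 1 ≤ K * (β₀ * K) * (R / ℓ) ^ p := by gcongr
    linarith
  set CN : ℝ := Real.sqrt ((∫ t, |k t|) * ∫ t, |k' t|) with hCNdef
  set NY : ℝ := (∫ x : ℝ, ‖Y x‖ ^ 2) ^ (1 / 2 : ℝ) with hNYdef
  have hNY0 : 0 ≤ NY := by positivity
  set EG : ℝ := G * (10 / (q * Real.sqrt (π * √q)) * Real.exp (-(X / 2)) * (1 + ∫ t, |k t|)) with hEGdef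
  have hkint0 : 0 ≤ ∫ t, |k t| := integral_nonneg fun t => abs_nonneg _
  have hEG0 : 0 ≤ EG := by positivity
  set ck : ℝ := Λ₂ * ((∫ t, t ^ 2 * |k' t|) + (∫ t, |t| * |k t|)) + (L₁ + L₂) * (∫ t, |t| * |k t|) with hckdef
  -- the maximum of `‖Y‖`
  obtain ⟨τ₀, hτ₀⟩ := (hYc.norm).exists_forall_ge_of_hasCompactSupport hYs.norm
  set S : ℝ := ‖Y τ₀‖ with hSdef
  have hSY : ∀ y : ℝ, ‖Y y‖ ≤ S := hτ₀
  have hS0 : 0 ≤ S := norm_nonneg _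
  -- the far part on both sides with `S_Y = S`
  set MH : ℝ := G * (10 / (q * Real.sqrt (π * √q)) * Real.exp (-(X / 2)) * (1 + ∫ t, |k t|) * NY)
        + ((1 + ∫ t, |k t|) * SL + Λ * ST + ck * S) with hMHdef
  have hright := model_far_pointwise_right hq hG hX hk hk'c hki hk1 hk'2 hkM hkχ hfar hY hYs hw hw2 hΛ hΛ₂ (d := c + ℓ) (b := c + R)
    (by linarith) (by linarith) hw₁ hwc hwpos hww₁ hβ₁c hβ₂ hb₁ hb₂ hL₁ hL₂ hsmall hβ₀ hp0 hgain hstag hgrow hSL hSY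
    (fun x hx => hST x ⟨by linarith [hx.1], hx.2⟩)
  have hleft := model_far_pointwise_left hq hG hX hk hk'c hki hk1 hk'2 hkM hkχ hfar hY hYs hw hw2 hΛ hΛ₂ (e := c - ℓ) (b := c - R)
    (by linarith) (by linarith) hw₁ hwc hwneg hww₁' hβ₁c hβ₂ hb₁ hb₂ hL₁ hL₂ hsmall hβ₀ hp0 hgain' hstag hgrow' hSL hSY
    (fun x hx => hST x ⟨hx.1, by linarith [hx.2]⟩)
  have hMH0 : 0 ≤ MH := by
    have h := hright.1 c ⟨le_rfl, by linarith⟩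
    have h' : 0 ≤ K * MH := (norm_nonneg _).trans h
    exact (mul_nonneg_iff_of_pos_left hK0).1 h'
  -- `‖Y_H‖ ≤ C_H · M_H` on the whole ball
  have hfarball : ∀ τ ∈ Icc (c - R) (c + R), ‖Y τ - ∫ y : ℝ, ((k (τ - y) : ℝ) : ℂ) * Y y‖ ≤ CH * MH := by
    intro τ hτ
    have hKMH : K * MH ≤ CH * MH := mul_le_mul_of_nonneg_right hKCH hMH0
    rcases le_or_gt τ c with hτc | hτc
    · rcases le_or_gt (c - ℓ) τ with h1 | h1
      · exact (hleft.1 τ ⟨h1, hτc⟩).trans hKMH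
      · have h2 := hleft.2 τ ⟨hτ.1, h1.le⟩
        refine h2.trans ?_
        have hwt : ((c - τ) / (c - (c - ℓ))) ^ p ≤ (R / ℓ) ^ p := by
          rw [show c - (c - ℓ) = ℓ by ring]
          exact Real.rpow_le_rpow (div_nonneg (by linarith) hℓ.le) (by rw [div_le_div_iff_of_pos_right hℓ]; linarith [hτ.1]) hp0
        calc ((c - τ) / (c - (c - ℓ))) ^ p * (K * (β₀ * K * MH)) ≤ (R / ℓ) ^ p * (K * (β₀ * K * MH)) :=
              mul_le_mul_of_nonneg_right hwt (by positivity)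
          _ = CH * MH := by simp only [hCHdef]; ring
    · rcases le_or_gt τ (c + ℓ) with h1 | h1
      · exact (hright.1 τ ⟨hτc.le, h1⟩).trans hKMH
      · have h2 := hright.2 τ ⟨h1.le, hτ.2⟩
        refine h2.trans ?_
        have hwt := (weight_le_on_ball (c := c) hℓ hℓR hp0 h1.le hτ.2).1
        calc ((τ - c) / (c + ℓ - c)) ^ p * (K * (β₀ * K * MH)) ≤ (R / ℓ) ^ p * (K * (β₀ * K * MH)) :=
              mul_le_mul_of_nonneg_right hwt (by positivity)
          _ = CH * MH := by simp only [hCHdef]; ring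
  -- the near part everywhere
  have hnear : ∀ τ : ℝ, ‖∫ y : ℝ, ((k (τ - y) : ℝ) : ℂ) * Y y‖ ≤ CN * NY :=
    fun τ => norm_piece_le_sqrt_mul_l2 hk hk'c hki hk'i hY hYs τ
  -- `‖Y‖ ≤ C_N N(Y) + C_H M_H` on the ball
  have hball : ∀ τ ∈ Icc (c - R) (c + R), ‖Y τ‖ ≤ CN * NY + CH * MH := by
    intro τ hτ
    calc ‖Y τ‖ = ‖(Y τ - ∫ y : ℝ, ((k (τ - y) : ℝ) : ℂ) * Y y) + ∫ y : ℝ, ((k (τ - y) : ℝ) : ℂ) * Y y‖ := by rw [sub_add_cancel]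
      _ ≤ ‖Y τ - ∫ y : ℝ, ((k (τ - y) : ℝ) : ℂ) * Y y‖ + ‖∫ y : ℝ, ((k (τ - y) : ℝ) : ℂ) * Y y‖ := norm_add_le _ _
      _ ≤ CH * MH + CN * NY := add_le_add (hfarball τ hτ) (hnear τ)
      _ = CN * NY + CH * MH := by ring
  -- absorption at the maximum
  set A : ℝ := (CN + CH * EG) * NY + CH * ((1 + ∫ t, |k t|) * SL + Λ * ST) with hAdef
  have hSLnn : 0 ≤ SL := (norm_nonneg _).trans (hSL 0)
  have hSTnn : 0 ≤ ST := (norm_nonneg _).trans (hST c ⟨by linarith, by linarith⟩)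
  have hA0 : 0 ≤ A := by positivity
  have hexp : CN * NY + CH * MH = A + CH * ck * S := by
    simp only [hAdef, hMHdef, hEGdef]; ring
  have hS : S ≤ 2 * A := by
    by_cases hτ₀b : τ₀ ∈ Icc (c - R) (c + R)
    · have h := hball τ₀ hτ₀b
      rw [hexp] at h
      have hck : CH * ck * S ≤ 1 / 2 * S := mul_le_mul_of_nonneg_right habs hS0
      have : S ≤ A + 1 / 2 * S := h.trans (by linarith)
      linarith
    · have : S = 0 := by simp only [hSdef, hYR τ₀ hτ₀b, norm_zero]
      linarith
  intro τ
  refine (hSY τ).trans (hS.trans (le_of_eq ?_))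
  simp only [hAdef, hCHdef, hCNdef, hEGdef, hKdef, hNYdef]

end Summit.NavierStokesRegularity.NavierStokesRegularity.Theorems.MatchedKernel

end
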